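import Summits.SmoothPoincare4.SmoothPoincare4.Theses.IsotropicCorkBracketing
import Summits.SmoothPoincare4.SmoothPoincare4.Theorems.IsotropicCorkBracketingRoundSideGivesBracketing
import Summits.SmoothPoincare4.SmoothPoincare4.Theorems.IsotropicCorkBracketingCorkReduction
import Summits.SmoothPoincare4.SmoothPoincare4.Theorems.IsotropicCorkBracketingSeamNull
import Summits.SmoothPoincare4.SmoothPoincare4.Theorems.IsotropicCorkBracketingNeumannBracketing
import Summits.SmoothPoincare4.SmoothPoincare4.Theorems.IsotropicCorkBracketingConformalPic
import Summits.SmoothPoincare4.SmoothPoincare4.Theorems.IsotropicCorkBracketingAssembly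
import Summits.SmoothPoincare4.SmoothPoincare4.Theorems.IsotropicCorkBracketingCorkPresentation
import Literature.Geometry.Riemannian.PICSphereFacts

/-!
# Census sketch — crux `CorkSideIsotropicFillIn` (stmt-SmoothPoincare4-11211), REDIRECT r1

Typed companions of `STRATEGY-CENSUS.md` (crux-strategist seat
`cstrat-stmt-SmoothPoincare4-11211-r1`, 2026-08-17). Nothing here is a route item.

* §1 `spc4_of_corkSideIsotropicFillIn` — THE STRENGTH CERTIFICATE: the crux implies the summit
  modulo exactly the route's two named-fact items (`CorkPresentation` = Θ₄ = 0 + Matveyev's cork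
  theorem, in-tree; `HamiltonChenTangZhu` = verbatim the Literature fact
  `hamilton_pic_sphere_four`), by composing theorems ALREADY LANDED in the tree
  (items 9833, 9832, 11212, 9828, 9827 and the route's deciding theorem). With the converse
  `SmoothPoincare4 → CorkSideIsotropicFillIn` unknown (and false as a proof scheme: no witness for
  a genuine cork is a pulled-back round metric, census §0), the crux is a certified
  STRENGTHENING of the summit with no separating witness (T1(d) / rule N).
* §2 the only split of the crux that types over the tree today — `CorkSideFillInSome`
  (the conclusion for SOME presentation of the cork twist) with the transport bridge
  `PresentationTransport` — and its modus-ponens assembly; census §Decomposition D1 explains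
  why it is the crux in costume ((c) fails in substance).
* §3 the pointwise strengthening `CorkSidePicFillIn` (census §Strengthen S1), typed.
-/

namespace Summit.SmoothPoincare4.SmoothPoincare4.Cruxes.CorkSideIsotropicFillIn.Census

open scoped Manifold ContDiff Topology
open Summit.SmoothPoincare4.SmoothPoincare4.Theses.IsotropicCorkBracketing
open Summit.SmoothPoincare4.SmoothPoincare4.Theorems

/-! ## §1 Strength certificate: crux ⇒ summit modulo the two named facts -/

/-- `CorkSideIsotropicFillIn ⇒ SmoothPoincare4` given the route's two named-fact items.
Composition of LANDED theorems only: `roundSideGivesBracketing_proof` (9833),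
`corkReduction_proof` (9832), `seamNull_proof` (11212), `neumannBracketing_proof` (9828),
`conformalPic_proof` (9827), `isotropicCorkBracketing_assembly_proof` (9834 = `closes`). -/
theorem spc4_of_corkSideIsotropicFillIn
    (hP : CorkPresentation) (hH : HamiltonChenTangZhu) (hS : CorkSideIsotropicFillIn) :
    _root_.SmoothPoincare4 :=
  isotropicCorkBracketing_assembly_proof
    (corkReduction_proof hP seamNull_proof neumannBracketing_proof
      (roundSideGivesBracketing_proof hS))
    conformalPic_proof hH

/-- The same with the Literature's named facts as the only hypotheses besides the crux:
`Θ₄ = 0` (Kervaire–Milnor), Matveyev's two-piece cork theorem, and Hamilton–Chen–Tang–Zhu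
(`hamilton_pic_sphere_four`, which is the item `HamiltonChenTangZhu` verbatim). -/
theorem spc4_of_corkSideIsotropicFillIn_of_facts
    (hΘ : Literature.Topology.FourManifolds.isHCobordant_sphere_of_homotopySphere_four)
    (hM : Literature.Topology.FourManifolds.Matveyev1996_decomposition.{0})
    (hH : Literature.Geometry.Riemannian.hamilton_pic_sphere_four)
    (hS : CorkSideIsotropicFillIn) : _root_.SmoothPoincare4 :=
  spc4_of_corkSideIsotropicFillIn (corkPresentation_of_facts hΘ hM) (fun M => hH M) hS

/-- For the record (k = 1 upward): the crux alone already gives the sibling crux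
`CorkIsotropicBracketing` (11210) by the landed glue 9833. -/
theorem corkIsotropicBracketing_of_corkSide :
    CorkSideIsotropicFillIn → CorkIsotropicBracketing :=
  roundSideGivesBracketing_proof

/-! ## §2 D1 — the ∃-presentation split (types today; costume) -/

/-- D1a — `CorkSideFillInSome`: the crux's conclusion for SOME closed presentation `P` of the
cork twist `C ∪_(φ∘τ) W` (instead of EVERY presentation). Same binders as the crux up to the
gluing data of `S⁴`; then `∃ P jC jW` with the gluing clauses as conjuncts. -/
def CorkSideFillInSome : Prop :=
  ∀ (C : Type) [TopologicalSpace C] [T2Space C] [SecondCountableTopology C] [ChartedSpace (EuclideanHalfSpace 4) C] [IsManifold (𝓡∂ 4) ∞ C] [CompactSpace C] [ContractibleSpace C] (ZC : Type) [TopologicalSpace ZC] [ChartedSpace (EuclideanSpace ℝ (Fin 3)) ZC] [IsManifold (𝓡 3) ∞ ZC] (ιC : ZC → C) (_ : Manifold.IsSmoothEmbedding (𝓡 3) (𝓡∂ 4) ∞ ιC) (_ : Set.range ιC = (𝓡∂ 4).boundary C) (W : Type) [TopologicalSpace W] [T2Space W] [SecondCountableTopology W] [ChartedSpace (EuclideanHalfSpace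 4) W] [IsManifold (𝓡∂ 4) ∞ W] [CompactSpace W] (ZW : Type) [TopologicalSpace ZW] [ChartedSpace (EuclideanSpace ℝ (Fin 3)) ZW] [IsManifold (𝓡 3) ∞ ZW] (ιW : ZW → W) (_ : Manifold.IsSmoothEmbedding (𝓡 3) (𝓡∂ 4) ∞ ιW) (_ : Set.range ιW = (𝓡∂ 4).boundary W) (φ : ZC ≃ₘ⟮𝓡 3, 𝓡 3⟯ ZW) (τ : ZC ≃ₘ⟮𝓡 3, 𝓡 3⟯ ZC) (kC : C → Metric.sphere (0 : EuclideanSpace ℝ (Fin 5)) 1) (kW : W → Metric.sphere (0 : EuclideanSpace ℝ (Fin 5)) 1), Manifold.IsSmoothEmbedding (𝓡∂ 4) (𝓡 4) ∞ kC → Manifold.IsSmoothEmbedding (𝓡∂ 4) (𝓡 4) ∞ kW → Set.range kC ∪ Set.range kW = Set.univ → (∀ a b, kC a = kW b ↔ ∃ z, a = ιC z ∧ b = ιW (φ z)) → ∃ (P : Type) (_ : TopologicalSpace P) (_ : T2Space P) (_ : SecondCountableTopology P) (_ : ChartedSpace (EuclideanSpace ℝ (Fin 4)) P) (_ : IsManifold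 (𝓡 4) ∞ P) (_ : CompactSpace P) (_ : MeasurableSpace P) (_ : BorelSpace P) (jC : C → P) (jW : W → P), Manifold.IsSmoothEmbedding (𝓡∂ 4) (𝓡 4) ∞ jC ∧ Manifold.IsSmoothEmbedding (𝓡∂ 4) (𝓡 4) ∞ jW ∧ Set.range jC ∪ Set.range jW = Set.univ ∧ (∀ a b, jC a = jW b ↔ ∃ z, a = ιC z ∧ b = ιW ((τ.trans φ) z)) ∧ ∃ G : Literature.Geometry.Lorentzian.PseudoRiemannianMetric (𝓡 4) ∞ (EuclideanSpace ℝ (Fin 4)) (TangentSpace (𝓡 4) : P → Type _), ∃ hG : G.IsRiemannian, ∃ _ : G.HasLeviCivita, (∃ f : P → Metric.sphere (0 : EuclideanSpace ℝ (Fin 5)) 1, ContMDiff (𝓡 4) (𝓡 4) ∞ f ∧ (∀ w, f (jW w) = kW w) ∧ ∀ (w : W) (v v' : TangentSpace (𝓡 4) (jW w)), G.val (jW w) v v' = inner ℝ (show EuclideanSpace ℝ (Fin 5) from mfderiv (𝓡 4) 𝓘(ℝ, EuclideanSpace ℝ (Fin 5)) (Subtype.val ∘ f) (jW w) v) (show EuclideanSpace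 ℝ (Fin 5) from mfderiv (𝓡 4) 𝓘(ℝ, EuclideanSpace ℝ (Fin 5)) (Subtype.val ∘ f) (jW w) v')) ∧ (∃ c : ℝ, 0 < c ∧ ∃ μ : P → ℝ, Continuous μ ∧ (∀ (x : P) (e : Fin 4 → TangentSpace (𝓡 4) x), G.IsOrthonormalFrame x e → μ x ≤ G.isotropicCurvature G.leviCivita x e) ∧ ∀ u : P → ℝ, ContMDiff (𝓡 4) 𝓘(ℝ, ℝ) 1 u → c * ∫ x in Set.range jC, u x ^ 2 ∂(Literature.Geometry.Lorentzian.riemannianMeasure (G.toContMDiffRiemannianMetric hG)) ≤ ∫ x in Set.range jC, (6 * G.gradSq u x + 3 * μ x * u x ^ 2) ∂(Literature.Geometry.Lorentzian.riemannianMeasure (G.toContMDiffRiemannianMetric hG)))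

/-- D1b — `PresentationTransport`: the bridge "one presentation suffices". TRUE on paper
(uniqueness of boundary gluings up to piece-preserving diffeomorphism, Hirsch 1976 Thm 8.2.1,
tree `GluingUniquenessControlled`; transport of the round clause and of Neumann positivity of
the isotropic form along a diffeomorphism `P ≃ P'` carrying `jC, jW` to `jC', jW'`), not in the
tree. As a PIECE it is an implication with open antecedent, so it gives neither the crux nor the
summit on its own — but the other piece `CorkSideFillInSome` is the crux in costume. -/
def PresentationTransport : Prop :=
  CorkSideFillInSome → CorkSideIsotropicFillIn

/-- D1 assembly — modus ponens (flag `trivial_seam`); recorded only to make the shape of the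
split explicit. The split fails BC2-redirect (c): `CorkSideFillInSome ⟺ CorkSideIsotropicFillIn`
in substance (census §Decomposition D1). -/
theorem corkSideIsotropicFillIn_of_some (h₁ : CorkSideFillInSome) (h₂ : PresentationTransport) :
    CorkSideIsotropicFillIn :=
  h₂ h₁

/-! ## §3 S1 — the pointwise strengthening (typed) -/

/-- S⁺_pw — `CorkSidePicFillIn`: as the crux, but the cork piece is asked to have POSITIVE
ISOTROPIC CURVATURE pointwise on `jC(C)` instead of a Neumann-positive isotropic form. Implies
the crux on paper (μ := the minimal isotropic curvature of `G`, continuous and `> 0` on the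
compact piece; `c := 3 min μ`; `gradSq ≥ 0`) — census §Strengthen S1: the added rigidity exposes
no tool (no h-principle rel a prescribed germ for PIC; the published PIC boundary deformations
need two-convex boundary, Chow 2021, void on corks). -/
def CorkSidePicFillIn : Prop :=
  ∀ (C : Type) [TopologicalSpace C] [T2Space C] [SecondCountableTopology C] [ChartedSpace (EuclideanHalfSpace 4) C] [IsManifold (𝓡∂ 4) ∞ C] [CompactSpace C] [ContractibleSpace C] (ZC : Type) [TopologicalSpace ZC] [ChartedSpace (EuclideanSpace ℝ (Fin 3)) ZC] [IsManifold (𝓡 3) ∞ ZC] (ιC : ZC → C) (_ : Manifold.IsSmoothEmbedding (𝓡 3) (𝓡∂ 4) ∞ ιC) (_ : Set.range ιC = (𝓡∂ 4).boundary C) (W : Type) [TopologicalSpace W] [T2Space W] [SecondCountableTopology W] [ChartedSpace (EuclideanHalfSpace 4) W] [IsManifold (𝓡∂ 4) ∞ W] [CompactSpace W] (ZW : Type) [TopologicalSpace ZW] [ChartedSpace (EuclideanSpace ℝ (Fin 3)) ZW] [IsManifold (𝓡 3) ∞ ZW] (ιW : ZW → W) (_ : Manifold.IsSmoothEmbedding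 (𝓡 3) (𝓡∂ 4) ∞ ιW) (_ : Set.range ιW = (𝓡∂ 4).boundary W) (φ : ZC ≃ₘ⟮𝓡 3, 𝓡 3⟯ ZW) (τ : ZC ≃ₘ⟮𝓡 3, 𝓡 3⟯ ZC) (kC : C → Metric.sphere (0 : EuclideanSpace ℝ (Fin 5)) 1) (kW : W → Metric.sphere (0 : EuclideanSpace ℝ (Fin 5)) 1), Manifold.IsSmoothEmbedding (𝓡∂ 4) (𝓡 4) ∞ kC → Manifold.IsSmoothEmbedding (𝓡∂ 4) (𝓡 4) ∞ kW → Set.range kC ∪ Set.range kW = Set.univ → (∀ a b, kC a = kW b ↔ ∃ z, a = ιC z ∧ b = ιW (φ z)) → ∀ (P : Type) [TopologicalSpace P] [T2Space P] [SecondCountableTopology P] [ChartedSpace (EuclideanSpace ℝ (Fin 4)) P] [IsManifold (𝓡 4) ∞ P] [CompactSpace P] [MeasurableSpace P] [BorelSpace P] (jC : C → P) (jW : W → P), Manifold.IsSmoothEmbedding (𝓡∂ 4) (𝓡 4) ∞ jC → Manifold.IsSmoothEmbedding (𝓡∂ 4) (𝓡 4) ∞ jW → Set.range jC ∪ Set.range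 jW = Set.univ → (∀ a b, jC a = jW b ↔ ∃ z, a = ιC z ∧ b = ιW ((τ.trans φ) z)) → ∃ G : Literature.Geometry.Lorentzian.PseudoRiemannianMetric (𝓡 4) ∞ (EuclideanSpace ℝ (Fin 4)) (TangentSpace (𝓡 4) : P → Type _), ∃ _ : G.IsRiemannian, ∃ _ : G.HasLeviCivita, (∃ f : P → Metric.sphere (0 : EuclideanSpace ℝ (Fin 5)) 1, ContMDiff (𝓡 4) (𝓡 4) ∞ f ∧ (∀ w, f (jW w) = kW w) ∧ ∀ (w : W) (v v' : TangentSpace (𝓡 4) (jW w)), G.val (jW w) v v' = inner ℝ (show EuclideanSpace ℝ (Fin 5) from mfderiv (𝓡 4) 𝓘(ℝ, EuclideanSpace ℝ (Fin 5)) (Subtype.val ∘ f) (jW w) v) (show EuclideanSpace ℝ (Fin 5) from mfderiv (𝓡 4) 𝓘(ℝ, EuclideanSpace ℝ (Fin 5)) (Subtype.val ∘ f) (jW w) v')) ∧ ∀ x ∈ Set.range jC, ∀ (e : Fin 4 → TangentSpace (𝓡 4) x), G.IsOrthonormalFrame x e → 0 < G.isotropicCurvature G.leviCivita x e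

end Summit.SmoothPoincare4.SmoothPoincare4.Cruxes.CorkSideIsotropicFillIn.Census
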